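import Literature.NumberTheory.EllipticCurves.GreenbergSelmer
import Literature.NumberTheory.EllipticCurves.IsogenyQuotient
import Literature.NumberTheory.EllipticCurves.PAdicHeights
import HarnessLib

/-!
# Dokchitser–Dokchitser 2015, Thm. A.1 (the `p`-isogenies of a Tate curve) read through the
# valuation of `j`: a `p`-isogeny out of a curve with SPLIT multiplicative reduction at an odd
# prime `p` whose kernel is fixed pointwise by the decomposition group at `p` (an ÉTALE kernel,
# not the `μ_p` of the Tate curve) divides `v_p(j)` by `p` — ONE named fact + proved bookkeeping

Cell `bsd-eis` (FULL-BSD rank ≤ 1 programme D-0033; HOME `run/shared/lean/pub/bsd-eis/`), seat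
`bsd-eis-k5-ty` gen 7 (typer), serving ASK-k5c4-2 / variant V2 of `HOME/k5-c4-MEMO-2.md` (crux 4
`BSDpOnCellC` = stmt-BirchSwinnertonDyer-19034, line b1, stub `stub_ctlOrSwitch`: the ℚ-RATIONAL
ÉTALE `p`-ISOGENY CHAIN `W₀ → W₁ → … → W_k` of §C2 there). STATEMENTS FIRST (D-0064: one file for
Appendix A of the source): ONE named PUBLISHED fact
(`thmA1_padicValRat_j_eq_mul_of_isogeny_ker_fixed`, +1 declared debt) and proved arithmetic /
plumbing; no `sorry`, no `instance`, no notation, no new notion (`WeierstrassCurve.Isogeny`,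
`WeierstrassCurve.HasSplitMultiplicativeReductionAtPrime`, `GreenbergSelmer.decomp`, `padicValRat`,
`WeierstrassCurve.geomTorsion` are the tree's).

## The print (T. Dokchitser, V. Dokchitser, *Local invariants of isogenous elliptic curves*, Trans.
## Amer. Math. Soc. 367 (2015) 4339–4358 = arXiv:1208.5519, store `paper:arxiv-1208.5519`; TAMS
## numbering, arXiv numbering in brackets; cell LIT-DOSSIER §50 (A) holds the VoR concordance)

* §1.1 Notation (p. 4341; store p0004 L23–27): "Throughout the paper `p` is a prime number, and
  `φ : E → E′` an isogeny of elliptic curves of degree `p`. … In §§3–6, the base field `K` is a finite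
  extension of `ℚ_l`; `l = p` is allowed"; "`v` normalised valuation", "`j, j′` `j`-invariants of `E`
  and `E′`".
* **Theorem A.1** [Thm. 38] (Appendix A "Tate curve and quadratic twists", p. 4354; store p0014
  L12–25), VERBATIM: "An elliptic curve `E/K` with split multiplicative reduction of type `I_n` is
  isomorphic to a Tate curve `E^{(q)}/K` for some Tate parameter `q ∈ 𝔪_K` with
  `v(q) = n = δ = -v(j) = c`. For a prime `p`, `E^{(q)}(K̄) ≅ K̄^×/q^ℤ` and `E^{(q)}[p] ≅ ⟨ζ_p, q^{1/p}⟩`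
  as Galois modules. There is a `K`-rational `p`-isogeny `E^{(q)}(K) = K^×/q^ℤ → K^×/q^{pℤ} =
  E^{(q^p)}(K)`, `z ↦ z^p`. The other `p`-isogenies from `E^{(q)}` are parametrised by choices of a
  `p`-th root of `q` in `K̄^×`, and given by `E^{(q)}(K) = K^×/q^ℤ → K^×/(q^{1/p})^ℤ = E^{(q^{1/p})}(K)`,
  `z ↦ z`. Such an isogeny is defined over `K` if and only if `q^{1/p} ∈ K`." (Proof: "[Sil2] V.3–V.5
  … [SerA] A.1.4".)
* Proposition 4.10 [Prop. 18] (p. 4348; store p0008 L107–126): "If `E` has potentially multiplicative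
  reduction, then `φ^*ω′/ω` = unit if `v(j) = p·v(j′)`, `p ×` unit otherwise", proof: "By the theory
  of the Tate curve (Theorem A.1), the pair `E, E′` is `E^{(q^p)}, E^{(q)}` (in some order), with
  `q ∈ 𝔪_K`. In particular, either `v(j) = p·v(j′)` or `v(j′) = p·v(j)`."
* Table 1 (p. 4340; store p0003 L52–55): "split mult., `v(j) = p·v(j′)`: `δ = pδ′`, `φ^*ω′/ω = 1`,
  `c/c′ = p`, Kodaira types `I_{pn}, I_n`" / "split mult., `p·v(j) = v(j′)`: `δ′ = pδ`, `φ^*ω′/ω = p`,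
  `c/c′ = 1/p`, `I_n, I_{pn}`".

## What is typed, and why it follows from the page

For an elliptic curve `W₀/ℚ` with SPLIT multiplicative reduction at an ODD prime `p`, an elliptic
`W′/ℚ` and a ℚ-isogeny `φ : W₀ → W′` with `#ker φ = p` (the tree's `Isogeny.degree`, the degree in
characteristic `0`) whose kernel is FIXED POINTWISE by the decomposition group `D_v ≤ Γ_ℚ` at the place
`v ∣ p` of the tree's chosen embedding (`GreenbergSelmer.decomp v`): `v_p(j(W₀)) = p · v_p(j(W′))`.
Dictionary (each step a clause of Thm. A.1): over `ℚ_p`, `W₀ ≅ E^{(q)}` with `v_p(j(W₀)) = -v(q)`;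
`ker φ ⊂ E^{(q)}[p] ≅ ⟨ζ_p, q^{1/p}⟩` is a `D_v`-stable line; the line `⟨ζ_p⟩` (kernel of `z ↦ z^p`,
target `E^{(q^p)}`, `v(j′) = p·v(j)`) is NOT fixed pointwise by `D_v` when `p` is odd (`ζ_p ∉ ℚ_p`),
so a pointwise-fixed kernel is one of "the other `p`-isogenies", `z ↦ z` onto `E^{(q^{1/p}ζ^i)}`
(defined over `ℚ_p` iff `q^{1/p}ζ^i ∈ ℚ_p` — consistent: its points are then `ℚ_p`-rational, i.e.
`D_v`-fixed), whose target has `v(j′) = -v(q)/p`; the quotient of `W₀` by `ker φ` is `W′` up to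
`ℚ̄_p`-isomorphism (Silverman AEC III.4.11/4.12), and `j` is an isomorphism invariant. Hence
`v_p(j(W₀)) = p·v_p(j(W′))` — Table 1's row "split mult., `v(j) = p·v(j′)`" (the ÉTALE direction,
`φ^*ω′/ω` a unit, Prop. 4.10). WHY `p ≠ 2`: at `p = 2` the `μ`-kernel `{±1}` IS fixed pointwise and
its quotient `E^{(q²)}` has `v(j′) = 2·v(j)`, so the statement would be false; the cell's pairs have
`p` odd. WHY SPLIT (as printed in Thm. A.1): for NON-split multiplicative reduction at an odd `p` no
line of `W₀[p]` is fixed pointwise by `D_v` (the étale quotient carries the unramified quadratic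
twist), so the hypothesis would be vacuous there; nothing is claimed beyond the split case. Over `ℚ`
rather than over a `p`-adic field: the hypotheses and the conclusion are read at the completion
`ℚ_p` (`HasSplitMultiplicativeReductionAtPrime` is the `ℤ_p`-minimal model's reduction type;
`padicValRat p` is `v`), which is the printed setting `K = ℚ_p`.

## Consumer, and what is proved here

k5-c4-MEMO-2 §C2: each step `W_i → W_{i+1} = W_i/Φ_i` of the étale chain (`Φ_i ≤ W_i[p]` of order
`p`, `Γ_ℚ`-stable, `D_v`-pointwise fixed; the quotient isogeny from the tree fact
`WeierstrassCurve.exists_isogeny_ker_eq_and_comp_eq_nsmul`, Silverman III.4.12) needs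
`v_p(j(W_i)) = p·v_p(j(W_{i+1}))` — (a) as the hypothesis `hj` of
`X2.dokchitserStevens_maninDatum_of_pIsogeny` / `X2.hasPrimeToManinDatum_of_pIsogeny` (the Manin
datum passes along), and (b) for TERMINATION (`v_p(j) < 0` strictly increases towards `0`). Proved
below (granted the fact): `….of_ker_eq_map` (the chain's kernel currency `Φ ≤ W[p]`, `ker φ = Φ`,
`Φ` pointwise `D_v`-fixed ⟹ the valuation relation; private plumbing `ker_fixed_of_ker_eq_map`) and
`….chain_step` (`v_p(j(W′)) < 0` and `v_p(j(W₀)) < v_p(j(W′))`, i.e. `|v_p(j)|` strictly decreases;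
private arithmetic `Int.lt_zero_and_lt_of_eq_prime_mul`). HONEST FRAMING: a named PUBLISHED
theorem stated as a `Prop`; a kernel proof would go through the tree's Tate-uniformisation library
(`Literature/NumberTheory/EllipticCurves/TateCurve/Uniformization*`, `TorsionGaloisModule*`) plus the
uniqueness of the quotient by a finite subgroup — not attempted here (typer seat). Nothing about BSD
is asserted; closes nothing by itself.

## References

* [DokchitserDokchitser2015LocalInvariants] T. Dokchitser, V. Dokchitser, Trans. AMS 367 (2015)
  4339–4358: Thm. A.1 (p. 4354) [arXiv:1208.5519 Thm. 38, store p0014 L12–25], Prop. 4.10 (p. 4348)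
  [Prop. 18, p0008 L107–126], Table 1 (p. 4340) [p0003 L52–55], §1.1 (p. 4341) [p0004 L23–27].
* [SilvermanAEC2009] J. H. Silverman, *The Arithmetic of Elliptic Curves*, 2nd ed.: Prop. III.4.12,
  Cor. III.4.11 (quotients by finite subgroups, uniqueness), III.1 Prop. 1.4(b) (`j` is an isomorphism
  invariant); [SilvermanATAEC1994] V.3–V.5 (Tate curve; Thm. A.1's "[Sil2]").
* Cell records: HOME/k5-c4-MEMO-2.md §C2, §3 V2, ASK-k5c4-2 (STATUS 2026-08-26T23:28:46Z);
  LIT-DOSSIER §50 (A) (VoR concordance, deposit HOME/lit/src/dd15-tams/); X2/ManinEtaleSwitch.lean.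
-/

set_option autoImplicit false

noncomputable section

open scoped Classical

open NumberField IsDedekindDomain Field WeierstrassCurve
  Literature.NumberTheory.EllipticCurves Literature.NumberTheory.EllipticCurves.GreenbergSelmer
  Literature.NumberTheory.GaloisRepresentations

namespace Literature.NumberTheory.EllipticCurves.DokchitserDokchitser2015

/-! ### §1. The named fact -/

/-- **Dokchitser–Dokchitser 2015, Thm. A.1 (valuation form, étale direction): a `p`-isogeny out of
a curve with split multiplicative reduction at an odd `p`, whose kernel is fixed pointwise by the
decomposition group at `p`, satisfies `v_p(j) = p·v_p(j′)`** — named fact. DATA: `W₀, W′/ℚ`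
elliptic; `p` an ODD prime (`p ≠ 2`: at `p = 2` the `μ₂`-kernel `{±1}` is pointwise fixed and the
conclusion fails); `W₀` with SPLIT multiplicative reduction at `p` (Thm. A.1's hypothesis; the
`ℤ_p`-minimal model, `HasSplitMultiplicativeReductionAtPrime`); a ℚ-isogeny `φ : W₀ → W′` with
`#ker φ = p` (`Isogeny.degree`); the place `v ∋ p` of `ℚ` and the decomposition group
`D_v = GreenbergSelmer.decomp v ≤ Γ_ℚ` of the tree's chosen embedding; HYPOTHESIS: every point of
`ker φ ⊂ W₀(ℚ̄)` is fixed by every `g ∈ D_v` (the kernel is `ℚ_p`-pointwise-rational, i.e. one of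
Thm. A.1's "other `p`-isogenies" `z ↦ z : E^{(q)} → E^{(q^{1/p})}`, not `z ↦ z^p` with kernel
`⟨ζ_p⟩`, `ζ_p ∉ ℚ_p`). CONCLUSION: `padicValRat p (j W₀) = p · padicValRat p (j W′)` (Thm. A.1:
`v(j(E^{(q)})) = -v(q)`, `v(j(E^{(q^{1/p})})) = -v(q)/p`; Table 1 row "split mult., `v(j) = p·v(j′)`",
Kodaira `I_{pn} → I_n`; Prop. 4.10's dichotomy "either `v(j) = p·v(j′)` or `v(j′) = p·v(j)`"). Module
docstring: dictionary, why odd, why split, why `ℚ_p`. PUBLISHED (refereed).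
[cite: DokchitserDokchitser2015LocalInvariants, Thm. A.1 (p. 4354; arXiv:1208.5519 Thm. 38, store p0014 L12–25) with Prop. 4.10 (p. 4348) and Table 1 (p. 4340)]
[cite: SilvermanAEC2009, Prop. III.4.12 and Cor. III.4.11 (the quotient by ker φ is W′ up to isomorphism)] -/
def thmA1_padicValRat_j_eq_mul_of_isogeny_ker_fixed : Prop :=
  ∀ (W₀ W' : WeierstrassCurve ℚ) [W₀.IsElliptic] [W'.IsElliptic] (p : ℕ) [Fact p.Prime], p ≠ 2 →
    W₀.HasSplitMultiplicativeReductionAtPrime p →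
    ∀ (φ : Isogeny W₀ W'), φ.degree = p →
    ∀ (v : HeightOneSpectrum (𝓞 ℚ)), ((p : ℕ) : 𝓞 ℚ) ∈ v.asIdeal →
      (∀ g ∈ decomp v, ∀ P : W₀.geomPoints, φ P = 0 → g • P = P) →
    padicValRat p W₀.j = p * padicValRat p W'.j

/-! ### §2. Proved bookkeeping: the chain's kernel currency and the termination arithmetic -/

section Plumbing

variable {W₀ W' : WeierstrassCurve ℚ} {p : ℕ}

/-- **Kernel currency of the étale chain ⟹ this file's hypothesis.** If the kernel of `φ` on
`W₀(ℚ̄)` is (the image of) a subgroup `Φ ≤ W₀[p]` of the geometric `p`-torsion every point of which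
is fixed by every `g ∈ D` (k5-c4's `exists_etaleLine_of_torsion_ne_zero` produces such `Φ`; the
quotient isogeny of `WeierstrassCurve.exists_isogeny_ker_eq_and_comp_eq_nsmul` has
`ker = Φ.map W₀[p].subtype`), then every point of `ker φ` is fixed by every `g ∈ D` (the `Γ_ℚ`-action
on `W₀[p]` is the restricted one, `AddSubgroup.torsionBy.coe_smul`). [folklore] -/
private theorem ker_fixed_of_ker_eq_map (φ : Isogeny W₀ W') {D : Subgroup (absoluteGaloisGroup ℚ)}
    {Φ : AddSubgroup (W₀.geomTorsion (p : ℤ))}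
    (hker : φ.toAddMonoidHom.ker = Φ.map (W₀.geomTorsion (p : ℤ)).subtype)
    (hΦ : ∀ g ∈ D, ∀ P ∈ Φ, g • P = P) :
    ∀ g ∈ D, ∀ P : W₀.geomPoints, φ P = 0 → g • P = P := by
  intro g hg P hP
  have hmem : P ∈ φ.toAddMonoidHom.ker := by
    rw [AddMonoidHom.mem_ker, Isogeny.coe_toAddMonoidHom]
    exact hP
  rw [hker, AddSubgroup.mem_map] at hmem
  obtain ⟨Q, hQ, rfl⟩ := hmem
  have h := congrArg (fun R : W₀.geomTorsion (p : ℤ) ↦ (R : W₀.geomPoints)) (hΦ g hg Q hQ)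
  simpa using h

/-- **Termination arithmetic of the étale chain**: if `a = p·b` in `ℤ` with `a < 0` and `1 < p`,
then `b < 0` and `a < b` — `|v_p(j)|` strictly decreases along `v_p(j) ↦ v_p(j)/p`. [folklore] -/
private theorem Int.lt_zero_and_lt_of_eq_prime_mul {a b : ℤ} (hp : 1 < p) (h : a = p * b) (ha : a < 0) :
    b < 0 ∧ a < b := by
  have hp0 : (0 : ℤ) < p := by exact_mod_cast Nat.zero_lt_of_lt hp
  have hb : b < 0 := by
    by_contra hb
    have hb' : 0 ≤ b := not_lt.mp hb
    have : 0 ≤ (p : ℤ) * b := mul_nonneg hp0.le hb'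
    omega
  refine ⟨hb, ?_⟩
  have hp1 : (1 : ℤ) < p := by exact_mod_cast hp
  nlinarith

end Plumbing

/-! ### §3. Unfolding corollaries of the fact -/

section Corollaries

variable {W₀ W' : WeierstrassCurve ℚ} [W₀.IsElliptic] [W'.IsElliptic] {p : ℕ} [Fact p.Prime]

/-- Granted the fact: the valuation relation in the étale chain's kernel currency
(`Φ ≤ W₀[p]` pointwise `D_v`-fixed with `ker φ = Φ`), the shape k5-c4's chain produces.
[cite: DokchitserDokchitser2015LocalInvariants, Thm. A.1 (p. 4354) and Prop. 4.10 (p. 4348)] -/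
theorem thmA1_padicValRat_j_eq_mul_of_isogeny_ker_fixed.of_ker_eq_map
    (h : thmA1_padicValRat_j_eq_mul_of_isogeny_ker_fixed) (hp2 : p ≠ 2)
    (hsplit : W₀.HasSplitMultiplicativeReductionAtPrime p) (φ : Isogeny W₀ W') (hdeg : φ.degree = p)
    {v : HeightOneSpectrum (𝓞 ℚ)} (hv : ((p : ℕ) : 𝓞 ℚ) ∈ v.asIdeal)
    {Φ : AddSubgroup (W₀.geomTorsion (p : ℤ))}
    (hker : φ.toAddMonoidHom.ker = Φ.map (W₀.geomTorsion (p : ℤ)).subtype)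
    (hΦ : ∀ g ∈ decomp v, ∀ P ∈ Φ, g • P = P) :
    padicValRat p W₀.j = p * padicValRat p W'.j :=
  h W₀ W' p hp2 hsplit φ hdeg v hv (ker_fixed_of_ker_eq_map φ hker hΦ)

/-- **One étale step of the chain, granted the fact: `v_p(j(W′)) < 0` and
`v_p(j(W₀)) < v_p(j(W′))`** — the target is again (potentially) multiplicative with `|v_p(j)|`
divided by `p`, so the ℚ-rational étale `p`-isogeny chain out of a split multiplicative curve
TERMINATES (no isogeny-class finiteness needed; k5-c4-MEMO-2 §C2). Inputs: the fact's hypotheses and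
`v_p(j(W₀)) < 0` (multiplicative reduction). [cite: DokchitserDokchitser2015LocalInvariants, Thm. A.1 (p. 4354), Table 1 (p. 4340: I_{pn} → I_n)] -/
theorem thmA1_padicValRat_j_eq_mul_of_isogeny_ker_fixed.chain_step
    (h : thmA1_padicValRat_j_eq_mul_of_isogeny_ker_fixed) (hp2 : p ≠ 2)
    (hsplit : W₀.HasSplitMultiplicativeReductionAtPrime p) (φ : Isogeny W₀ W') (hdeg : φ.degree = p)
    {v : HeightOneSpectrum (𝓞 ℚ)} (hv : ((p : ℕ) : 𝓞 ℚ) ∈ v.asIdeal)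
    (hfix : ∀ g ∈ decomp v, ∀ P : W₀.geomPoints, φ P = 0 → g • P = P)
    (hj : padicValRat p W₀.j < 0) :
    padicValRat p W'.j < 0 ∧ padicValRat p W₀.j < padicValRat p W'.j :=
  Int.lt_zero_and_lt_of_eq_prime_mul (Fact.out : p.Prime).one_lt
    (h W₀ W' p hp2 hsplit φ hdeg v hv hfix) hj

end Corollaries

end Literature.NumberTheory.EllipticCurves.DokchitserDokchitser2015

end
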